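import Literature.Geometry.Lorentzian.CurvatureNaturality
import Literature.Geometry.Lorentzian.MetricValCongr
import Literature.Geometry.Lorentzian.HypersurfaceRestriction
import Literature.Geometry.Lorentzian.IsometryProofs
import Literature.Geometry.Lorentzian.LeviCivitaProofs
import HarnessLib

/-!
# Scalar curvature under a local isometry defined on an open set

Topic `Literature/Geometry/Lorentzian` (general pseudo-Riemannian API, next to
`CurvatureNaturality.lean`). A brick of the proof programme of
`Literature.Geometry.Riemannian.BaerHankePscGluing` (Bär–Hanke 2023, §3: the scalar curvature of
`(M, g)` near the boundary is computed for the cylinder metric `dt² + g_t` on `∂M × [0, ε)` to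
which `g` is isometric through the normal exponential map — a local diffeomorphism defined on an
open slab only).

* `scalarCurvature_eq_of_val_eq_pullbackBilin` — if `E : X → P` is `C^∞` with injective
  differential at every point of an open set `U ⊆ X` (equidimensional models) and the metric `G`
  of `X` agrees on `U` with the pullback `E^* g` of the metric `g` of `P`, then
  `scal_G(q) = scal_g(E q)` for `q ∈ U`. Proof: restrict to the open submanifold `U`
  (`TopologicalSpace.Opens`); there `G|_U` and `(E|_U)^* g` are honest pullback metrics
  (`PseudoRiemannianMetric.comap`) with the same values, so O'Neill's naturality
  `scalarCurvature_comap` (Ch. 3, Prop. 3.59) on both sides and `scalarCurvature_congr_of_val_eq`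
  conclude.

Everything is proved; no definitions, no named facts (D-0026).

## References

* B. O'Neill, *Semi-Riemannian geometry* (1983), Ch. 3, Prop. 3.59, pp. 90–91. [ONeill1983]
* C. Bär, B. Hanke, *Boundary conditions for scalar curvature*, arXiv:2012.09127, §3, (7)–(9).
  [BarHanke2023]
-/

noncomputable section

open Bundle Set Function Filter
open scoped Manifold ContDiff Topology

namespace Literature.Geometry.Lorentzian

namespace PseudoRiemannianMetric

variable {EP : Type*} [NormedAddCommGroup EP] [NormedSpace ℝ EP] {HP : Type*} [TopologicalSpace HP]
  {J : ModelWithCorners ℝ EP HP} {P : Type*} [TopologicalSpace P] [ChartedSpace HP P]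
  [IsManifold J ∞ P]
  {EX : Type*} [NormedAddCommGroup EX] [NormedSpace ℝ EX] {HX : Type*} [TopologicalSpace HX]
  {IX : ModelWithCorners ℝ EX HX} {X : Type*} [TopologicalSpace X] [ChartedSpace HX X]
  [IsManifold IX ∞ X]
  [FiniteDimensional ℝ EP] [FiniteDimensional ℝ EX] [CompleteSpace EP] [CompleteSpace EX]
  (g : PseudoRiemannianMetric J ∞ EP (TangentSpace J : P → Type _)) [g.HasLeviCivita]
  (G : PseudoRiemannianMetric IX ∞ EX (TangentSpace IX : X → Type _)) [G.HasLeviCivita]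

/-- **Scalar curvature under a local isometry defined on an open set** (O'Neill 1983, Ch. 3,
Prop. 3.59, localized): let `E : X → P` be `C^∞` with injective differential at every point of
an open set `U ⊆ X`, `dim X = dim P`, and suppose the metric `G` of `X` agrees on `U` with the
pullback of `g`: `G_q(v, w) = g_{E q}(dE v, dE w)` for `q ∈ U`. Then `scal_G(q) = scal_g(E q)`
for every `q ∈ U`. [cite: ONeill1983, Ch. 3, Prop. 3.59] -/
theorem scalarCurvature_eq_of_val_eq_pullbackBilin {E : X → P} {U : Set X} (hU : IsOpen U)
    (hE : ∀ q ∈ U, ContMDiffAt IX J ∞ E q)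
    (hEinj : ∀ q ∈ U, Function.Injective (mfderiv IX J E q))
    (hdim : Module.finrank ℝ EX = Module.finrank ℝ EP)
    (hval : ∀ q ∈ U, G.val q = pullbackBilin (I := J) (I' := IX) E g.val q)
    {q : X} (hq : q ∈ U) :
    G.scalarCurvature q = g.scalarCurvature (E q) := by
  set W : TopologicalSpace.Opens X := ⟨U, hU⟩ with hW
  -- the two honest pullback metrics on the open submanifold `W`
  set Φ : W → P := E ∘ Subtype.val with hΦdef
  have hΦ : ContMDiff IX J (∞ + 1) Φ := fun u ↦
    (hE u.1 u.2).comp u (contMDiff_subtype_val u)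
  have hEu : ∀ u : W, MDifferentiableAt IX J E u.1 := fun u ↦
    (hE u.1 u.2).mdifferentiableAt (by simp)
  have hΦ' : ∀ u, Function.Injective (mfderiv IX J Φ u) := fun u ↦ by
    rw [hΦdef, mfderiv_comp_subtypeVal (hEu u)]
    exact hEinj u.1 u.2
  have hι : ContMDiff IX IX (∞ + 1) (Subtype.val : W → X) := contMDiff_subtype_val
  have hι' : ∀ u : W, Function.Injective (mfderiv IX IX (Subtype.val : W → X) u) := fun u ↦ by
    rw [mfderiv_subtypeVal]
    exact fun v w h ↦ h
  set gΦ := g.comap (contMDiff_pullbackBilin_holds (I := J) (M := P) (I' := IX) (N := W)) Φ hΦ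
    hΦ' hdim with hgΦ
  set GW := G.comap (contMDiff_pullbackBilin_holds (I := IX) (M := X) (I' := IX) (N := W))
    Subtype.val hι hι' rfl with hGW
  haveI := gΦ.hasLeviCivita
  haveI := GW.hasLeviCivita
  -- they have the same values
  have hvals : ∀ u : W, gΦ.val u = GW.val u := by
    intro u
    refine ContinuousLinearMap.ext fun v ↦ ContinuousLinearMap.ext fun w ↦ ?_
    show pullbackBilin (I := J) (I' := IX) Φ g.val u v w =
      pullbackBilin (I := IX) (I' := IX) (Subtype.val : W → X) G.val u v w
    rw [pullbackBilin_apply, pullbackBilin_apply, hΦdef, mfderiv_comp_subtypeVal (hEu u),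
      mfderiv_subtypeVal, hval u.1 u.2, pullbackBilin_apply]
    rfl
  have h1 : gΦ.scalarCurvature ⟨q, hq⟩ = g.scalarCurvature (Φ ⟨q, hq⟩) :=
    scalarCurvature_comap g _ hΦ hΦ' hdim ⟨q, hq⟩
  have h2 : GW.scalarCurvature ⟨q, hq⟩ = G.scalarCurvature q :=
    scalarCurvature_comap G _ hι hι' rfl ⟨q, hq⟩
  rw [← h2, ← scalarCurvature_congr_of_val_eq hvals ⟨q, hq⟩, h1]
  rfl

end PseudoRiemannianMetric

end Literature.Geometry.Lorentzian
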